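import Mathlib
import HarnessLib
import Summits.HubbardSuperconductivity.HubbardSuperconductivity.Theorems.KLProgrammeKLRegimeTwoVolumeTowerBudgetGeom
import Summits.HubbardSuperconductivity.HubbardSuperconductivity.Theorems.KLProgrammeKLRegimeTwoVolumeSpineDataDefs

/-!
# Route `KLProgramme` — crux K3, VL child `KLRegimeVolumeLimitV17F2` (stmt-HubbardSuperconductivity-20440), skeleton «cauchy» v11: THE PROFILE CONSTANT
# `A_j = O(ε_{j+1}·32^{−j})` AND THE SMALLNESS INEQUALITY PER SCALE AS ONE BOUND ON `ε` (assembler kit, last mile of S3/S5 of ASSEMBLY-DESIGN-g15;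
# seat hubbard-kl-k3c4-p1 g15; `--supports` 20440)

With the scale laws of the doors — `κ_j² = k₀²·8^{−j}` (p3: `k₀² = 16·Cκ·klE0`), `aW_j ≤ a₀·4^j`, caps `cRb_j ≤ cR₀`, `cCb_j ≤ cC₀`, `cW_j ≤ cW₀`, `δb_j ≤ δb₀` — and the radii of
`…TowerRatiosOfLaws` (`q_j = 1/(2(e²(κ_j+r₀κ_j))²) = 8^j/D_q`, `D_q = 2e⁴(1+r₀)²k₀²`), the geometric-majorant constant of `…TowerBudgetGeom.towerBudget_le_geom`
at `n = j+1` is `≤ ε_{j+1}·32^{−j}·K` with `K` scale-free (`towerBudgetConst_le_laws`), and then the two smallness inequalities of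
`…TowerSmallnessOfLaws.towerSmallness_of_laws` hold as soon as `ε_{j+1} ≤ ε⋆` with `ε⋆` scale-free and explicit (`towerSmallnessIneq_of_laws`) — the `U₀/c₅`
condition of `stub_vl_towerData`.  Also: `q_of_kappa_law` (the closed form of `q_j`), `klWtBudget_two_eq_inv_pow` (`τ_j = CE·ε·(4^n)⁻¹`), and
`WtProfileEven.zeroDegree` (the degree-`0` slot of a profile budget may be set to `0` — it carries no pin).

Proofs only; no definition; elementary. [cite: BenfattoGiulianiMastropietro2006, §2.7 (2.77)-(2.80)]
-/

noncomputable section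

namespace Summit.HubbardSuperconductivity.HubbardSuperconductivity.Theorems.TwoVolumeDefect

set_option linter.dupNamespace false -- summit = problem name (single-conjunct summit), D-0017

open Finset Literature.MathematicalPhysics.QuantumLattice GrassmannAlgebra Literature.Probability.LatticeModels

/-- **The degree-`0` slot of an even weighted profile carries no pin**: the budget may be set to `0` there. [folklore] -/
theorem WtProfileEven.zeroDegree {V M Ns : ℕ} [NeZero V] {W : GrassmannAlgebra ℂ ((SpaceTimeIdx V M × SectorLeg Ns) × Fin 2)} {Λ : ℝ} {N : ℕ → ℝ}
    (hW : WtProfileEven W Λ N) : WtProfileEven W Λ (fun m => if m = 0 then 0 else N m) where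
  nonneg m := by split_ifs; exacts [le_rfl, hW.nonneg m]
  le m' j x := by
    rcases Nat.eq_zero_or_pos m' with h0 | hpos
    · subst h0; exact j.elim0
    · rw [if_neg hpos.ne']; exact hW.le m' j x

end Summit.HubbardSuperconductivity.HubbardSuperconductivity.Theorems.TwoVolumeDefect

namespace Summit.HubbardSuperconductivity.HubbardSuperconductivity.Theorems.TwoVolumeSource

set_option linter.dupNamespace false -- summit = problem name (single-conjunct summit), D-0017

open Summit.HubbardSuperconductivity.HubbardSuperconductivity.Theorems.KLProgrammeLegKernels
open Summit.HubbardSuperconductivity.HubbardSuperconductivity.Theorems.KLRegimeSplit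
open Summit.HubbardSuperconductivity.HubbardSuperconductivity.Theorems.EngineV8

/-- **The closed form of `q_j`** under the Gram law `κ_j² = k₀²·8^{−j}`: `1/(2(e²(κ_j + r₀κ_j))²) = 8^j/(2e⁴(1+r₀)²k₀²)`. [folklore] -/
theorem q_of_kappa_law {κ k₀ r₀ : ℝ} {j : ℕ} (hk₀ : 0 < k₀) (hr₀ : 0 ≤ r₀) (hκ : κ ^ 2 = k₀ ^ 2 * ((8 : ℝ) ^ j)⁻¹) :
    1 / (2 * (Real.exp 2 * (κ + r₀ * κ)) ^ 2) = (8 : ℝ) ^ j / (2 * Real.exp 2 ^ 2 * (1 + r₀) ^ 2 * k₀ ^ 2) := by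
  have h8 : (0 : ℝ) < 8 ^ j := by positivity
  have hE : 0 < Real.exp 2 := Real.exp_pos 2
  have hsq : (Real.exp 2 * (κ + r₀ * κ)) ^ 2 = Real.exp 2 ^ 2 * (1 + r₀) ^ 2 * κ ^ 2 := by ring
  rw [hsq, hκ]
  field_simp

/-- **`τ_n = klWtBudget P Q U n 2 = CE·ε_n·(4^n)⁻¹`** (power form of `…EngineWtBudget.klWtBudget_two`). [folklore] -/
theorem klWtBudget_two_eq_inv_pow (P : SplitConsts) (Q : EngConsts) (U : ℝ) (n : ℕ) :
    klWtBudget P Q U n 2 = Q.CE * epsCoupling P U n * ((4 : ℝ) ^ n)⁻¹ := by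
  rw [klWtBudget_two, show (-(2 * (n : ℤ))) = -(((2 * n : ℕ) : ℤ)) by push_cast; ring, zpow_neg, zpow_natCast, pow_mul]
  norm_num

/-- **THE PROFILE CONSTANT UNDER THE LAWS**: the constant of `towerBudget_le_geom` at `n = j+1`, `q = 8^j/D_q`, is at most `ε_{j+1}·(32^j)⁻¹·K` with
`K = CE·D_q/4·(C₀·(1 + 8·CE·D_q) + 1 + ε̄·CE′·(1 + 8·CE′·D_q)/4)` whenever `ε_{j+1} ≤ ε̄` (`τ = CE·ε_{j+1}·(4^{j+1})⁻¹`).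
[cite: BenfattoGiulianiMastropietro2006, §2.7 (2.77)-(2.80)] -/
theorem towerBudgetConst_le_laws (P : SplitConsts) (Q Q' : EngConsts) (U : ℝ) (j : ℕ) (hCE : 0 ≤ Q.CE) (hCE' : 0 ≤ Q'.CE)
    (hε : 0 < epsCoupling P U (j + 1)) {εb : ℝ} (hεb : epsCoupling P U (j + 1) ≤ εb) {Dq : ℝ} (hDq : 0 < Dq) {C₀ : ℝ}
    {q τ : ℝ} (hq : q = (8 : ℝ) ^ j / Dq) (hτ : τ = Q.CE * epsCoupling P U (j + 1) * ((4 : ℝ) ^ (j + 1))⁻¹) :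
    ((32 : ℝ) ^ (j + 1))⁻¹ * C₀ * (Q.CE * epsCoupling P U (j + 1) * 8 ^ (j + 1) / q +
        (epsCoupling P U (j + 1))⁻¹ * (Q.CE * epsCoupling P U (j + 1) * 8 ^ (j + 1) / q) ^ 2) + τ / q +
      τ * (((32 : ℝ) ^ (j + 1))⁻¹ * (Q'.CE * epsCoupling P U (j + 1) * 8 ^ (j + 1) / q +
        (epsCoupling P U (j + 1))⁻¹ * (Q'.CE * epsCoupling P U (j + 1) * 8 ^ (j + 1) / q) ^ 2)) ≤
      epsCoupling P U (j + 1) * ((32 : ℝ) ^ j)⁻¹ *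
        (Q.CE * Dq / 4 * (C₀ * (1 + 8 * Q.CE * Dq) + 1 + εb * Q'.CE * (1 + 8 * Q'.CE * Dq) / 4)) := by
  set ε := epsCoupling P U (j + 1) with hεdef
  have hε0 := hε.le
  have h8 : (0 : ℝ) < 8 ^ j := by positivity
  have hq0 : 0 < q := by rw [hq]; positivity
  -- the scale-free ratios
  have hρ : Q.CE * ε * 8 ^ (j + 1) / q = 8 * Q.CE * Dq * ε := by rw [hq, pow_succ]; field_simp
  have hρ' : Q'.CE * ε * 8 ^ (j + 1) / q = 8 * Q'.CE * Dq * ε := by rw [hq, pow_succ]; field_simp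
  have hτq : τ / q = Q.CE * Dq * ε * ((32 : ℝ) ^ j)⁻¹ / 4 := by
    rw [hτ, hq, pow_succ, show (32 : ℝ) ^ j = 4 ^ j * 8 ^ j by rw [← mul_pow]; norm_num]
    field_simp
  have h32 : ((32 : ℝ) ^ (j + 1))⁻¹ = ((32 : ℝ) ^ j)⁻¹ / 32 := by rw [pow_succ, mul_inv]; ring
  rw [hρ, hρ', hτq, h32, hτ]
  -- everything is `ε·(32^j)⁻¹ ×` scale-free; compare the brackets
  have hW : 0 ≤ ((32 : ℝ) ^ j)⁻¹ := by positivity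
  have h4 : ((4 : ℝ) ^ (j + 1))⁻¹ ≤ 1 / 4 := by
    rw [one_div]; exact inv_anti₀ (by norm_num) (by
      calc (4 : ℝ) = 4 ^ 1 := (pow_one _).symm
        _ ≤ 4 ^ (j + 1) := pow_le_pow_right₀ (by norm_num) (by omega))
  have h4' : 0 ≤ ((4 : ℝ) ^ (j + 1))⁻¹ := by positivity
  -- piece 1: `(32^j)⁻¹/32 · C₀ · (8 CE Dq ε + ε⁻¹ (8 CE Dq ε)²) = ε (32^j)⁻¹ · C₀ CE Dq (1 + 8 CE Dq)/4`
  have hp1 : ((32 : ℝ) ^ j)⁻¹ / 32 * C₀ * (8 * Q.CE * Dq * ε + ε⁻¹ * (8 * Q.CE * Dq * ε) ^ 2) =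
      ε * ((32 : ℝ) ^ j)⁻¹ * (Q.CE * Dq / 4 * (C₀ * (1 + 8 * Q.CE * Dq))) := by
    field_simp
    ring
  -- piece 2: `τ/q = ε (32^j)⁻¹ · CE Dq/4`
  have hp2 : Q.CE * Dq * ε * ((32 : ℝ) ^ j)⁻¹ / 4 = ε * ((32 : ℝ) ^ j)⁻¹ * (Q.CE * Dq / 4 * 1) := by ring
  -- piece 3: `τ · ((32^j)⁻¹/32 · (8 CE' Dq ε + ε⁻¹ (8 CE' Dq ε)²)) = ε (32^j)⁻¹ · CE Dq/4 · (ε CE' (1 + 8 CE' Dq)) · (4^{j+1})⁻¹ ≤ … εb …/4`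
  have hp3 : Q.CE * ε * ((4 : ℝ) ^ (j + 1))⁻¹ * (((32 : ℝ) ^ j)⁻¹ / 32 * (8 * Q'.CE * Dq * ε + ε⁻¹ * (8 * Q'.CE * Dq * ε) ^ 2)) =
      ε * ((32 : ℝ) ^ j)⁻¹ * (Q.CE * Dq / 4 * (ε * Q'.CE * (1 + 8 * Q'.CE * Dq))) * ((4 : ℝ) ^ (j + 1))⁻¹ := by
    field_simp
    ring
  rw [hp1, hp2, hp3]
  have hX : 0 ≤ ε * ((32 : ℝ) ^ j)⁻¹ * (Q.CE * Dq / 4 * (ε * Q'.CE * (1 + 8 * Q'.CE * Dq))) := by positivity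
  have hle3 : ε * ((32 : ℝ) ^ j)⁻¹ * (Q.CE * Dq / 4 * (ε * Q'.CE * (1 + 8 * Q'.CE * Dq))) * ((4 : ℝ) ^ (j + 1))⁻¹ ≤
      ε * ((32 : ℝ) ^ j)⁻¹ * (Q.CE * Dq / 4 * (εb * Q'.CE * (1 + 8 * Q'.CE * Dq) / 4)) := by
    calc _ ≤ ε * ((32 : ℝ) ^ j)⁻¹ * (Q.CE * Dq / 4 * (ε * Q'.CE * (1 + 8 * Q'.CE * Dq))) * (1 / 4) := mul_le_mul_of_nonneg_left h4 hX
      _ = ε * ((32 : ℝ) ^ j)⁻¹ * (Q.CE * Dq / 4 * (ε * Q'.CE * (1 + 8 * Q'.CE * Dq) / 4)) := by ring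
      _ ≤ _ := by
          have hb : ε * Q'.CE * (1 + 8 * Q'.CE * Dq) / 4 ≤ εb * Q'.CE * (1 + 8 * Q'.CE * Dq) / 4 := by
            have : 0 ≤ Q'.CE * (1 + 8 * Q'.CE * Dq) / 4 := by positivity
            nlinarith
          have hc : 0 ≤ ε * ((32 : ℝ) ^ j)⁻¹ * (Q.CE * Dq / 4) := by positivity
          nlinarith
  nlinarith [hle3]

/-- `4^j·(32^j)⁻¹ = (8^j)⁻¹`. [folklore] -/
private theorem four_pow_mul_inv_pow (j : ℕ) : (4 : ℝ) ^ j * ((32 : ℝ) ^ j)⁻¹ = ((8 : ℝ) ^ j)⁻¹ := by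
  rw [show (32 : ℝ) ^ j = 4 ^ j * 8 ^ j by rw [← mul_pow]; norm_num, mul_inv, ← mul_assoc, mul_inv_cancel₀ (by positivity), one_mul]

/-- **THE TWO SMALLNESS INEQUALITIES OF `towerSmallness_of_laws` FROM ONE BOUND ON `ε`**: with `κ_j² = k₀²·8^{−j}`, `aW_j ≤ a₀·4^j`, caps
`cRb_j ≤ cR₀`, `cCb_j ≤ cC₀`, `cW_j ≤ cW₀`, `δb_j ≤ δb₀`, the profile constants `A_j ≤ ε_{j+1}·(32^j)⁻¹·K` and
`ε_{j+1}·(256·e²·(a₀+cR₀+cC₀+1)·(42·cW₀+4·δb₀+8e)·K) ≤ k₀²` at every scale, both inequalities hold (`4^j·32^{−j} = 8^{−j}` absorbs the growth of `aW_j/κ_j²`).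
[cite: BenfattoGiulianiMastropietro2006, §2.7 (2.77)-(2.80)] -/
theorem towerSmallnessIneq_of_laws (κ aW cRb cCb cW δb A ε : ℕ → ℝ) {k₀ a₀ cR₀ cC₀ cW₀ δb₀ K : ℝ}
    (hκ2 : ∀ j, κ j ^ 2 = k₀ ^ 2 * ((8 : ℝ) ^ j)⁻¹) (haW0 : ∀ j, 0 ≤ aW j) (haW : ∀ j, aW j ≤ a₀ * 4 ^ j)
    (hcRb0 : ∀ j, 0 ≤ cRb j) (hcRb : ∀ j, cRb j ≤ cR₀) (hcCb0 : ∀ j, 0 ≤ cCb j) (hcCb : ∀ j, cCb j ≤ cC₀)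
    (hcW1 : ∀ j, 1 ≤ cW j) (hcW : ∀ j, cW j ≤ cW₀) (hδb0 : ∀ j, 0 ≤ δb j) (hδb : ∀ j, δb j ≤ δb₀) (hK : 0 ≤ K)
    (hε0 : ∀ j, 0 ≤ ε j) (hA : ∀ j, A j ≤ ε (j + 1) * ((32 : ℝ) ^ j)⁻¹ * K)
    (hsmall : ∀ j, ε (j + 1) * (256 * Real.exp 1 ^ 2 * (a₀ + cR₀ + cC₀ + 1) * (42 * cW₀ + 4 * δb₀ + 8 * Real.exp 1) * K) ≤ k₀ ^ 2) :
    (∀ j, Real.exp 1 * (aW j + cRb j + cCb j + 1) * (42 * cW j + 4 * δb j + 8 * Real.exp 1) * A j ≤ κ j ^ 2 / 2) ∧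
    (∀ j, Real.exp 1 * (aW (j + 1) + cRb (j + 1) + cCb (j + 1) + 1) * (42 * cW (j + 1) + 4 * δb (j + 1) + 8 * Real.exp 1) * (4 * Real.exp 1 * A j) ≤
      κ (j + 1) ^ 2 / 2) := by
  have he : 0 < Real.exp 1 := Real.exp_pos 1
  have he1 : 1 ≤ Real.exp 1 := Real.one_le_exp (by norm_num)
  have ha₀ : 0 ≤ a₀ := by have h := (haW0 0).trans (haW 0); simpa using h
  have hcR₀ : 0 ≤ cR₀ := (hcRb0 0).trans (hcRb 0)
  have hcC₀ : 0 ≤ cC₀ := (hcCb0 0).trans (hcCb 0)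
  have hcW₀ : 1 ≤ cW₀ := (hcW1 0).trans (hcW 0)
  have hδb₀ : 0 ≤ δb₀ := (hδb0 0).trans (hδb 0)
  set G := a₀ + cR₀ + cC₀ + 1 with hG
  set W₀ := 42 * cW₀ + 4 * δb₀ + 8 * Real.exp 1 with hW₀
  have hG0 : 0 ≤ G := by positivity
  have hW₀0 : 0 ≤ W₀ := by positivity
  -- the per-scale weight against `G·4^i·W₀`
  have hweight : ∀ i, Real.exp 1 * (aW i + cRb i + cCb i + 1) * (42 * cW i + 4 * δb i + 8 * Real.exp 1) ≤ Real.exp 1 * (G * 4 ^ i) * W₀ := by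
    intro i
    have h4 : (1 : ℝ) ≤ 4 ^ i := one_le_pow₀ (by norm_num)
    have h1 : aW i + cRb i + cCb i + 1 ≤ G * 4 ^ i := by
      have : (cR₀ + cC₀ + 1) * 1 ≤ (cR₀ + cC₀ + 1) * 4 ^ i := mul_le_mul_of_nonneg_left h4 (by positivity)
      nlinarith [haW i, hcRb i, hcCb i]
    have h2 : 42 * cW i + 4 * δb i + 8 * Real.exp 1 ≤ W₀ := by simp only [hW₀]; linarith [hcW i, hδb i]
    have h10 : 0 ≤ aW i + cRb i + cCb i + 1 := by linarith [haW0 i, hcRb0 i, hcCb0 i]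
    have h20 : 0 ≤ 42 * cW i + 4 * δb i + 8 * Real.exp 1 := by have := hcW1 i; have := hδb0 i; positivity
    calc Real.exp 1 * (aW i + cRb i + cCb i + 1) * (42 * cW i + 4 * δb i + 8 * Real.exp 1)
        ≤ Real.exp 1 * (G * 4 ^ i) * (42 * cW i + 4 * δb i + 8 * Real.exp 1) := by gcongr
      _ ≤ Real.exp 1 * (G * 4 ^ i) * W₀ := by gcongr
  have hweight0 : ∀ i, 0 ≤ Real.exp 1 * (aW i + cRb i + cCb i + 1) * (42 * cW i + 4 * δb i + 8 * Real.exp 1) := fun i => by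
    have := haW0 i; have := hcRb0 i; have := hcCb0 i; have := hcW1 i; have := hδb0 i; positivity
  -- the scale-free smallness `e G W₀ K ε ≤ k₀²/(256 e)`
  have hcore : ∀ j, Real.exp 1 * G * W₀ * K * ε (j + 1) * (256 * Real.exp 1) ≤ k₀ ^ 2 := fun j => by
    have h := hsmall j
    have hid : Real.exp 1 * G * W₀ * K * ε (j + 1) * (256 * Real.exp 1) = ε (j + 1) * (256 * Real.exp 1 ^ 2 * G * W₀ * K) := by ring
    rw [hid]; exact h
  refine ⟨fun j => ?_, fun j => ?_⟩
  · have h1 := mul_le_mul_of_nonneg_left (hA j) (hweight0 j)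
    have h2 : Real.exp 1 * (aW j + cRb j + cCb j + 1) * (42 * cW j + 4 * δb j + 8 * Real.exp 1) * (ε (j + 1) * ((32 : ℝ) ^ j)⁻¹ * K) ≤
        Real.exp 1 * (G * 4 ^ j) * W₀ * (ε (j + 1) * ((32 : ℝ) ^ j)⁻¹ * K) :=
      mul_le_mul_of_nonneg_right (hweight j) (by have := hε0 (j + 1); positivity)
    have h3 : Real.exp 1 * (G * 4 ^ j) * W₀ * (ε (j + 1) * ((32 : ℝ) ^ j)⁻¹ * K) = Real.exp 1 * G * W₀ * K * ε (j + 1) * ((8 : ℝ) ^ j)⁻¹ := by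
      rw [← four_pow_mul_inv_pow j]; ring
    rw [hκ2 j]
    have h8 : 0 < ((8 : ℝ) ^ j)⁻¹ := by positivity
    have h4 : Real.exp 1 * G * W₀ * K * ε (j + 1) * ((8 : ℝ) ^ j)⁻¹ ≤ k₀ ^ 2 * ((8 : ℝ) ^ j)⁻¹ / 2 := by
      have hc := hcore j
      have hx : 0 ≤ Real.exp 1 * G * W₀ * K * ε (j + 1) := by have := hε0 (j + 1); positivity
      have hX : Real.exp 1 * G * W₀ * K * ε (j + 1) ≤ k₀ ^ 2 / 2 := by
        have hprod := mul_nonneg hx (sub_nonneg.2 he1)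
        nlinarith [hc, hprod]
      have := mul_le_mul_of_nonneg_right hX h8.le
      linarith
    linarith [h1, h2, h3.le, h4]
  · have h1 := mul_le_mul_of_nonneg_left (mul_le_mul_of_nonneg_left (hA j) (by positivity : (0 : ℝ) ≤ 4 * Real.exp 1)) (hweight0 (j + 1))
    have h2 : Real.exp 1 * (aW (j + 1) + cRb (j + 1) + cCb (j + 1) + 1) * (42 * cW (j + 1) + 4 * δb (j + 1) + 8 * Real.exp 1) *
        (4 * Real.exp 1 * (ε (j + 1) * ((32 : ℝ) ^ j)⁻¹ * K)) ≤ Real.exp 1 * (G * 4 ^ (j + 1)) * W₀ * (4 * Real.exp 1 * (ε (j + 1) * ((32 : ℝ) ^ j)⁻¹ * K)) :=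
      mul_le_mul_of_nonneg_right (hweight (j + 1)) (by have := hε0 (j + 1); positivity)
    have h3 : Real.exp 1 * (G * 4 ^ (j + 1)) * W₀ * (4 * Real.exp 1 * (ε (j + 1) * ((32 : ℝ) ^ j)⁻¹ * K)) =
        16 * Real.exp 1 * (Real.exp 1 * G * W₀ * K * ε (j + 1)) * ((8 : ℝ) ^ j)⁻¹ := by
      rw [← four_pow_mul_inv_pow j, pow_succ (4 : ℝ) j]; ring
    rw [hκ2 (j + 1), pow_succ (8 : ℝ) j, mul_inv]
    have h8 : 0 < ((8 : ℝ) ^ j)⁻¹ := by positivity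
    have h4 : 16 * Real.exp 1 * (Real.exp 1 * G * W₀ * K * ε (j + 1)) * ((8 : ℝ) ^ j)⁻¹ ≤ k₀ ^ 2 * (((8 : ℝ) ^ j)⁻¹ * 8⁻¹) / 2 := by
      have hc := hcore j
      have hX : 16 * Real.exp 1 * (Real.exp 1 * G * W₀ * K * ε (j + 1)) ≤ k₀ ^ 2 / 16 := by
        have hid : 16 * Real.exp 1 * (Real.exp 1 * G * W₀ * K * ε (j + 1)) = Real.exp 1 * G * W₀ * K * ε (j + 1) * (256 * Real.exp 1) / 16 := by ring
        rw [hid]; linarith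
      have := mul_le_mul_of_nonneg_right hX h8.le
      have hid2 : k₀ ^ 2 * (((8 : ℝ) ^ j)⁻¹ * 8⁻¹) / 2 = k₀ ^ 2 / 16 * ((8 : ℝ) ^ j)⁻¹ := by ring
      rw [hid2]; exact this
    linarith [h1, h2, h3.le, h4]

/-- **The two smallness inequalities BELOW A TOP SCALE `J`** (the usable form: `ε_{j+1}` grows with `j`, so the bound on `ε` is asked only for `j < J`;
`towerSmallness_of_laws` reads `hS` at `j < J` and `hS'` at `j + 1 < J`). [cite: BenfattoGiulianiMastropietro2006, §2.7 (2.77)-(2.80)] -/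
theorem towerSmallnessIneq_of_laws_lt (J : ℕ) (κ aW cRb cCb cW δb A ε : ℕ → ℝ) {k₀ a₀ cR₀ cC₀ cW₀ δb₀ K : ℝ}
    (hκ2 : ∀ j, κ j ^ 2 = k₀ ^ 2 * ((8 : ℝ) ^ j)⁻¹) (haW0 : ∀ j, 0 ≤ aW j) (haW : ∀ j, aW j ≤ a₀ * 4 ^ j)
    (hcRb0 : ∀ j, 0 ≤ cRb j) (hcRb : ∀ j, cRb j ≤ cR₀) (hcCb0 : ∀ j, 0 ≤ cCb j) (hcCb : ∀ j, cCb j ≤ cC₀)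
    (hcW1 : ∀ j, 1 ≤ cW j) (hcW : ∀ j, cW j ≤ cW₀) (hδb0 : ∀ j, 0 ≤ δb j) (hδb : ∀ j, δb j ≤ δb₀) (hK : 0 ≤ K)
    (hε0 : ∀ j, 0 ≤ ε j) (hA : ∀ j, j < J → A j ≤ ε (j + 1) * ((32 : ℝ) ^ j)⁻¹ * K)
    (hsmall : ∀ j, j < J → ε (j + 1) * (256 * Real.exp 1 ^ 2 * (a₀ + cR₀ + cC₀ + 1) * (42 * cW₀ + 4 * δb₀ + 8 * Real.exp 1) * K) ≤ k₀ ^ 2) :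
    (∀ j, j < J → Real.exp 1 * (aW j + cRb j + cCb j + 1) * (42 * cW j + 4 * δb j + 8 * Real.exp 1) * A j ≤ κ j ^ 2 / 2) ∧
    (∀ j, j + 1 < J → Real.exp 1 * (aW (j + 1) + cRb (j + 1) + cCb (j + 1) + 1) * (42 * cW (j + 1) + 4 * δb (j + 1) + 8 * Real.exp 1) *
      (4 * Real.exp 1 * A j) ≤ κ (j + 1) ^ 2 / 2) := by
  classical
  -- truncate `A` and `ε` above the top scale and apply the unrestricted form
  obtain ⟨A', hA'⟩ : ∃ A' : ℕ → ℝ, ∀ j, A' j = if j < J then A j else 0 := ⟨_, fun _ => rfl⟩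
  obtain ⟨ε', hε'⟩ : ∃ ε' : ℕ → ℝ, ∀ i, ε' i = if i < J + 1 then ε i else 0 := ⟨_, fun _ => rfl⟩
  have hε'0 : ∀ i, 0 ≤ ε' i := fun i => by rw [hε']; split_ifs; exacts [hε0 i, le_rfl]
  have hAA' : ∀ j, A' j ≤ ε' (j + 1) * ((32 : ℝ) ^ j)⁻¹ * K := fun j => by
    rw [hA', hε']
    by_cases hj : j < J
    · rw [if_pos hj, if_pos (by omega)]; exact hA j hj
    · rw [if_neg hj]; split_ifs <;> first | positivity | (have := hε0 (j + 1); positivity)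
  have hsmall' : ∀ j, ε' (j + 1) * (256 * Real.exp 1 ^ 2 * (a₀ + cR₀ + cC₀ + 1) * (42 * cW₀ + 4 * δb₀ + 8 * Real.exp 1) * K) ≤ k₀ ^ 2 := fun j => by
    rw [hε']
    by_cases hj : j < J
    · rw [if_pos (by omega)]; exact hsmall j hj
    · rw [if_neg (by omega), zero_mul]; positivity
  obtain ⟨h1, h2⟩ := towerSmallnessIneq_of_laws κ aW cRb cCb cW δb A' ε' hκ2 haW0 haW hcRb0 hcRb hcCb0 hcCb hcW1 hcW hδb0 hδb hK hε'0 hAA' hsmall'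
  refine ⟨fun j hj => ?_, fun j hj => ?_⟩
  · have h := h1 j; rw [hA', if_pos hj] at h; exact h
  · have h := h2 j; rw [hA', if_pos (by omega)] at h; exact h

end Summit.HubbardSuperconductivity.HubbardSuperconductivity.Theorems.TwoVolumeSource

end
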